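import Summits.CriticalPhenomena.CardyFormulaZ2.Theorems.CardyMagicRigidityMarkovCascadeDefs
import Summits.CriticalPhenomena.CardyFormulaZ2.Theorems.CardyMagicRigidityNestingRigidityOneGenerationZ2
import Summits.CriticalPhenomena.CardyFormulaZ2.Theorems.CardyMagicRigidityNestingRigidityOneGenerationT
import Summits.CriticalPhenomena.CardyFormulaZ2.Theorems.CardyMagicRigidityNestingRigidityWindowLocality
import Literature.Barriers.CriticalPhenomena.NestingTransformBlindness

/-!
# Skeleton line `markov-cascade-one-generation` for crux `NestingRigidity` (stmt-CriticalPhenomena-4835)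

Route `CardyMagicRigidity`, crux r3 `NestingRigidity` ≡ `MagicFormulaZ2 → MagicFormulaT → LoopLimitZ2EqT`
(literally, `Iff.rfl`; refuter rreview d82cb032).  As a `Prop` the crux is implied by the target `X =
LoopLimitZ2EqT` alone, so the whole value of a skeleton is the INTENDED PROOF it names; every stub below is
typed so that it is (a) a genuine theorem-to-prove of the line and (b) true in the believed world (each
conclusion is a consequence of bond-ℤ² ~ site-𝕋 universality in domains), hence attackable only through its
intended mechanism — which the line card states stub by stub.

## The line (idea card `Ideas/markov-cascade-one-generation.md`, crux-ideate r1 ideator 1; triage r1: 3 × pass)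

LEVER: `IsInterfaceLoop ω γ` (resp. `IsSiteInterfaceLoop ω γ`) reads `ω` only on the edges listed in `γ`
(resp. on the sites bordering the darts of `γ`), so "`γ` is an interface loop" is a cylinder event on `γ`'s
own edges/sites and, under the product measure, inside and outside are conditionally independent given it;
with `∫ f = 0` and nested-or-disjoint interiors every loop NOT inside `γ` weighs `2cos(π/3) = 1`.  Hence the
exact ONE-GENERATION FACTORISATION on both lattices (`stub_oneGenerationZ2`, `stub_oneGenerationT`: lattice
theorems, no hypothesis of the crux) and the disintegration `Λ_δ(f) = E[M_{ℓ̃_R}(f)] + (no-loop error)` of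
the full-plane transform into CONDITIONAL (wired-domain) transforms.  The crux is then cut, in RELATIVE
LATTICE CLOTHING (bond-ℤ² at mesh `δ` against site-𝕋 at mesh `δ`, no continuum object in any statement,
exactly as the route types `X`), along the Markov cascade of CLOSED-boundary-condition domain ensembles
`domLoopsZ2 U δ ω = bondLoopConfig δ 0 (ω ∩ meshEdges U δ)`, `domLoopsT U δ ω = siteLoopConfig δ (ω ∩
triMeshVertices U δ)` (all of `U`ᶜ closed — the ensemble Camia–Newman explore, `CLE6.lean`'s
`triLoopCollection` convention):

* `stub_deAveraging` (XL, LOAD-BEARING, rank 1): both magic formulas (+ the two factorisations) ⇒ the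
  closed-b.c. DOMAIN transforms of the two lattices merge, `M^{ℤ²}_{U_δ,δ}(f) − M^{𝕋}_{U_δ,δ}(f) → 0`, for the
  winding interiors `U_δ = holeOf (u_δ)` of every family of loops `u_δ → u` (in the loop metric of `d_CN`)
  with a TWO-SIDED limit loop `u` (every trace point accumulated by interior and exterior: Jordan curves,
  CLE₆-type pinched loops; no retraced arcs) and every admissible `f` compactly supported in `holeOf u`
  (`DomainTransfer`).  Domains are indexed by LOOPS because the holes of the cascade are exactly winding
  interiors of (lattice, then continuum-pinched) loops.  This is the card's honest gap "DE-AVERAGING" typed as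
  the first stub after (2c), as triage r1-3 asked; route (b) of the card (boundary-blind atoms) is dead
  (triage r1-1 F3), route (a) (outside positive-cone guards reweighting the law of the enclosing loop while
  the disintegration persists) is the intended mechanism; the VALUE of the domain transform is never claimed
  (F3: it carries a `log CR` drift, no domain magic formula is known) — only the ℤ²/𝕋 merger.
* `stub_kernelUniqueness` (XL⁻, rank 2): merged domain transforms for ALL such domains ⇒ merged
  FIRST-GENERATION KERNELS `Q_D` = laws of the outermost loops (`firstGen`) of the closed-b.c. ensembles, in
  DKKMO's `d_CN` (`KernelTransfer`).  This is the card's Transfer C⁺ (first half, "domain nesting rigidity"):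
  by the one-generation identity `M_D(f) = E_{Q_D}[∏ᵢ 2cos(θ_{ℓᵢ}(f)+π/3) · M^{open}_{int ℓᵢ}(f)]` both
  kernels solve the same equations for all `f ⊂⊂ D` and all sub-domains simultaneously; the input that
  breaks the smoothing-transform degeneracy (triage r1-2 (b)) is exactly F3 turned into a resource — the hole
  transform `M_{int ℓ}(f)` HEARS THE SHAPE of the hole through its boundary (`log CR`) term — plus
  non-crossing (holes nested-or-disjoint) taken from the lattice, never from the transform.
* `stub_cascadeReconstruction` (L, rank 3): merged kernels along all convergent loop families (continuous-
  convergence form) ⇒ merged closed-b.c. domain LAWS in balls (`DomainLawTransfer`): iterate the exact lattice Markov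
  decomposition (first generation, then independent colour-swapped / dual closed-b.c. ensembles in the holes)
  to finite depth; the continuity in the ROUGH random hole that the ℤ² side cannot supply by identity
  coupling (4 alternating arms along a dimension-7/4 boundary: expected `ε^{-1/2}` near-pinchings) is taken
  from the 𝕋 side (Camia–Newman convergence in converging Jordan domains + Radó continuity of CLE₆), which is
  why every domain statement of the line is in continuous-convergence form `u_δ → u`.
* `stub_windowLocality` (M, provable now): merged closed-b.c. laws in all balls ⇒ `X`: a full-plane loop
  inside `B(0, 1/η)` IS a loop of the closed-b.c. ensemble of `B(0, R)`, `R > 1/η + δ`, by the cylinder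
  property, so the identity coupling gives `d_CN(full, ball ensemble) ≤ η` surely; then
  `cnLawEDist_triangle`.

`NestingRigidity_of` composes the six stubs into the crux BY NAME (kernel-checked, no `sorry`):
`X = windowLocality (cascadeReconstruction (kernelUniqueness (deAveraging OGF_ℤ² OGF_𝕋 MFZ2 MFT)))`.

## Gen-2 revision (this file; gen-1 skeleton `4af5569e805e…`, 2026-08-15T23:58Z)

One change, at `domLoopsZ2`: the `ℤ²` closed-b.c. domain ensemble is RESTRICTED to the interface loops that
visit an edge of `U_δ`.  Reason (junk found by the gen-2 audit, see the docstring of `domLoopsZ2`): the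
medial loop representation of `ℤ²` is fully packed, so closing the exterior edges surrounds EVERY exterior
vertex with a deterministic type-`1` diamond, while the honeycomb ensemble has no loop outside `U`; as
`LoopConfig.IsClose` has no lower diameter cut-off, every `d_CN` law comparison of the unrestricted
ensembles fails surely — `KernelTransfer` and `DomainLawTransfer` were false as typed, `stub_kernelUniqueness`
false in the believed world and `stub_cascadeReconstruction` / `stub_windowLocality` vacuous.  With the
restriction all six statements are again consequences of `ℤ² ~ 𝕋` universality in domains; the stub set,
the signatures' shape and `NestingRigidity_of` are otherwise those of gen-1.

## Disproof used

`disproof_path` (`run/gate/evidence/stmt-CriticalPhenomena-4835/…-Disproof.lean`, cdisprove v1.1) is not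
mounted in this jail (same for all three triagers); its negative lemmas LANDED as the barrier
`Literature.Barriers.CriticalPhenomena.NestingTransformBlindness` (p68977), imported below and honoured:
(i) type-blindness / (ii) null-interior blindness / (iii) covering-multiplicity blindness of `A_f` — no stub
infers types, non-degeneracy or covering degree from transform data: `firstGen`, `domLoopsZ2/T` carry the
lattice typing and the lattice loops themselves; (iv) `hasNestingTransform_union` /
`superposition_half_variance` / `sswMGF_three_eq_six` (the conditional CLE₃ ⊔ CLE₃ impostor) — excluded at
`stub_kernelUniqueness`, whose hypothesis is not "a law with the CLE₆ transform" but the interface-Markov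
one-generation identity in EVERY domain for the two Bernoulli ensembles (an independent union has no
interface-Markov property: the hidden layer crosses every interface).  No `_false_without_` theorem of the
Disproof is readable here; the recorded structural obstruction (rreview: the complex height measure has total
variation `2^{#loops}`) is honoured by never forming a complex measure — all objects are positive percolation
laws and `d_CN`.  No `Negative/` lemma has landed for this crux (nothing to import); `ledger negatives
--problem CriticalPhenomena`: 7 entries, none on nesting transforms or domain Markov properties.

## Lead reshape r1 (seat -1, 2026-08-16T07:10Z) — layout after wave 1

* Vocabulary + the six statement `Prop`s + glue `nestingRigidity_of_statements` LANDED as the definitions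
  module `Theorems/CardyMagicRigidityMarkovCascadeDefs.lean` (p78338) — imported, no local copies.
* STUB 1 `stub_oneGenerationZ2` LANDED (p87130, `…OneGenerationZ2.lean`; helpers `…OneGenerationZ2Cells`
  p80845 (cell trichotomy), `…OneGenerationZ2Interiors` p84193 (nested-or-disjoint winding interiors,
  cylinder property), `…OneGenerationZ2Indep` p83222 (coordinate independence under `bondPercolation`)).
* STUB 2 `stub_oneGenerationT` LANDED (p84251, `…OneGenerationT.lean`; helpers `…OneGenerationTInterior`
  p80610 (Jordan trichotomy for honeycomb interface loops), `…OneGenerationTLocality` p81461).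
* STUB 6 `stub_windowLocality` LANDED (p80876, `…WindowLocality.lean`; shared cylinder module
  `…InterfaceLoopCylinder` p80909).
* STUB 4 helpers landed: `…HoleGeometry` p81808, `…DomainEnsembleHonesty` p81996, `…DomainEnsembleSupport`
  p81823, reduction `…KernelUniquenessReduction` p82327; STUB 5 helpers: `…DomainEnsembleGluing` p81565,
  `…KernelTransferFamilies` p82648, `…CascadeFirstGeneration` p83358.
* OPEN (the only `sorry`s): STUB 3 `stub_deAveraging` (lead; crux-sized), STUB 4 `stub_kernelUniqueness`
  (blocked: NEW fact `firstGen_limitTransfer` = the rigidity content in subsequential form), STUB 5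
  `stub_cascadeReconstruction` (blocked: NEW fact Camia–Newman continuity of the closed-b.c. 𝕋 ensemble
  along loop-convergent hole families, `camiaNewman_domLoopsT_continuity`).

## Lead pass r2 (continuation seat c1-0, 2026-08-16T10:50Z) — inputs of STUBS 3/5 registered as helper stubs

Composition unchanged (three open `stub_*`, `NestingRigidity_of` by name).  A second lead (seat -2) drives the
sibling line `positive-cone-weight-doubling` concurrently, so this pass registers its sub-goals with
`workitem stub-add` (no competing `skeleton check` sweep).  Wave 1 (seven workers, one per registered helper;
signatures verbatim in `work/stubs/WaveOneSignatures.lean` of the lead's folder):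
* `tendsto_measure_setOf_sparse_bondLoopConfig` — typed micro-loop density of bond-`ℤ²` (BOTH types; type 0 via
  open faces) — the below-scale soup obligation of every `d_CN` statement of the line (and of `X` itself);
* `isClose_of_dense_of_forall_big` — deterministic reduction: `IsClose ε` from `ε/4`-density of both types in the
  window + matching of the loops of diameter `≥ ε/8` (reusable by `KernelTransfer`, `DomainLawTransfer`, `X`);
* `mem_siteLoopConfig_compl_iff` (colour flip on `𝕋` = reversal + type swap) and `mem_bondLoopConfig_dualConfig_iff`
  (planar duality on `ℤ²` = reversal + type swap + half-mesh shift `δ(1+i)/2`) — the two TYPE-SWAP identities STUB 5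
  uses inside a first-generation loop;
* `tight_encard_bigLoops_bondLoopConfig` / `tight_encard_bigLoops_siteLoopConfig` — the number of loops of diameter
  `≥ η` in `B(0,R)` is tight as `δ → 0⁺` on both lattices (finite-depth tightness of the cascade; AB / RSW–BK);
* `exists_outermost_interfaceLoop` — outermost-loop selection on `ℤ²` (first formal step of STUB 3's guarded
  disintegration `Λ_δ(f) = Σ_γ M_γ(f)·P(ℓ̃ = γ) + error`).
STUBS 3/4 (de-averaging; first-generation rigidity) are held by the lead: they are the crux's open content
(barrier `NestingTransformBlindness` §(iv) + Disproof v1.3 Targets: "STUB 4 inherits the crux difficulty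
undiminished"); no worker is assigned to them.

RESULT OF WAVES 1–2 (cycle 1, all ACCEPTED `--supports stmt-CriticalPhenomena-4835`; modules
`Theorems/CardyMagicRigidityNestingRigidity<X>.lean`, namespace of this file):
* `BondLoopDensity` p98524 (`tendsto_measure_setOf_sparse_bondLoopConfig`; `faceLoop`/`vertexLoop` typing) ·
  `DomLoopDensityZ2` p101294 · `DomLoopDensityT` p101250 — typed micro-loop soups, full plane and balls;
* `IsCloseReduction` p97407 (`isClose_of_dense_of_forall_big`) · `IsCloseLocalReduction` p102671
  (`isClose_of_localDense_of_forall_big`) · `BigLoopsReduction` p101170 (`cnLawEDist_le_of_bigLoops_matched`: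
  for the full-plane pair of `X`, matching the loops of diameter `≥ ε/8` under ANY coupling off probability `ε/2`
  witnesses `d_CN ≤ ε`) — the soup is formally separated from the macroscopic loops;
* `SiteColourFlip` p97547 (`mem_siteLoopConfig_compl_iff`, `PT_map_compl`) · `OpenBCTypeSwapT` p101985
  (`cnLawEDist_openBC_typeSwap_T = 0`) · `BondDuality` p98914 (`mem_bondLoopConfig_dualConfig_iff`,
  `isInterfaceLoop_dualConfig`) · `OpenBCDualityZ2` p102553 (`cnLawEDist_openBC_duality_Z2 = 0`) — the two
  TYPE-SWAP identities of STUB 5, configuration level and law level (open b.c. = type-swapped closed b.c.);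
* `BigLoopsTightT` p97932 · `BigLoopsTightZ2Part1` p99007 + `BigLoopsTightZ2` p100437 — the number of loops of
  diameter `≥ η` in `B(0,R)` is tight on both lattices (finite depth of the cascade: depth ≤ 1 + #big loops);
* `OutermostLoop` p97488 (`exists_outermost_interfaceLoop`) — STUB 3's selection step.
What STUB 5 still lacks is not bookkeeping but the 𝕋-side law-continuity in converging (non-Jordan, two-sided)
holes — Camia–Newman, tree named fact `Literature.Probability.Percolation.exists_isCNLFamily_tendsto` (unproved)
+ Carathéodory/Radó continuity (absent) — and the generation-by-generation coupling assembly; STUBS 3/4 are the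
crux content.
-/

noncomputable section

open MeasureTheory Set Filter
open scoped Topology BigOperators ENNReal Real

namespace Summit.CriticalPhenomena.CardyFormulaZ2.Cruxes.NestingRigidity.MarkovCascadeOneGeneration

open Literature.Probability.RandomPlanarGeometry Literature.Probability.Percolation
  Literature.Probability.LatticeModels
open Summit.CriticalPhenomena.CardyFormulaZ2.Theses.CardyMagicRigidity

/-! ### Landed stubs (imported): S1, S2, S6 -/

example : OneGenerationZ2 := oneGenerationZ2_of_stub
example : OneGenerationT := oneGenerationT_of_stub
example : WindowLocality := stub_windowLocality

/-! ### The registered stubs -/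

-- stub_oneGenerationZ2: LANDED (imported; see module docstring)

-- stub_oneGenerationT: LANDED (imported; see module docstring)

/-- STUB 3 (XL, LOAD-BEARING, the hardest) — `DeAveraging`: from the FULL-PLANE Gaussian transform
identities on both lattices (`MagicFormulaZ2`, `MagicFormulaT`) to the merger of the closed-b.c. DOMAIN
transforms along every convergent loop family `u_δ → u` (`DomainTransfer`).  Intended mechanism (card §Why-it-bites (5), route (a)
only — route (b) "atoms are boundary blind" is refuted by triage F3): summing STUB 1 / STUB 2 over the
outermost loop `ℓ̃_R` surrounding `supp f` inside `B(0,R)` disintegrates `Λ_δ(f) = E[M_{ℓ̃_R}(f)] +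
O(P(no loop))` on each lattice; inserting outside GUARDS `g` from the positive cone (`∫(f+g) = 0`, weights
of `g`-cutting loops `≥ 0`, resonant charges `±π/6` — triage: thicken circles to annuli, charges `|·| ≤ π/6`)
keeps the disintegration exact while tilting the law of `ℓ̃_R` through an explicit, tunable family; both
lattices satisfy the same guarded identities with the same Gaussian right-hand sides, and `D ↦ M_{D,δ}(f)`
is RSW-equicontinuous on each lattice for domains far from `supp f`; the bet is that this family of averaged
identities separates the conditional transforms.  Why it might fail: two interface-Markov cascades with
equal full-plane transforms and different domain transforms (card falsifier (1)/(3)); the averaging kernel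
(law of `ℓ̃_R` given the guards) is itself lattice-dependent, so the identities are of the form
`E^{ℤ²}[M^{ℤ²} · G] = E^{𝕋}[M^{𝕋} · G] + o(1)` with two unknowns each — closing this needs a bootstrap over
scales (the de-averaged identity at scale `r` feeds the law of `ℓ̃` at scale `R`). -/
theorem stub_deAveraging :
    OneGenerationZ2 → OneGenerationT → MagicFormulaZ2 → MagicFormulaT → DomainTransfer := by
  sorry

/-- STUB 4 (XL⁻) — `KernelUniqueness`: merged closed-b.c. domain transforms in the holes of ALL convergent
loop families and all admissible `f` ⇒ merged first-generation kernels in `d_CN` along the same families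
(`DomainTransfer → KernelTransfer`).  Intended mechanism (Transfer C⁺ of the card, first half): pass to
subsequential limits along `u_δ → u` (Aizenman–Burchard tightness of interface loops on both lattices; on `𝕋` the limit kernel is
CLE₆'s by Camia–Newman); by STUBS 1–2 summed over first generations, both limit kernels `Q, Q'` satisfy
`E_Q[Ψ_f] = E_{Q'}[Ψ_f]` for all `f ⊂⊂ D`, `Ψ_f(ℓ₁, ℓ₂, …) = ∏ᵢ 2cos(θ_{ℓᵢ}(f) + π/3) · M^{open}_{int ℓᵢ}(f)`
with the SAME hole transforms (merged by hypothesis, open b.c. = colour-swap / planar dual of closed b.c.);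
small-amplitude and multi-bump expansions of `λ ↦ Ψ_{λf}` read off mixed moments of the phases AND of the
boundary terms of the hole transforms, which depend on the hole through `log CR(z; hole)`-type quantities
(triage F3: `M_{B(x,r₂+η)}(f)/Λ(f) ~ (η/r₂)^{λ/2π}`) — the first generation is HEARD through its holes; the
law of the random field `z ↦ CR(z, hole(z))` determines the holes, and non-crossing (holes nested-or-
disjoint, from the lattice) turns holes back into loops.  No template: the κ = 4 analogue (ASW two-valued
sets) uses an honest field and `cos`, not `2cos` (triage r1-2 (a)); here no complex measure is formed.  Why
it might fail: dark directions — first-generation statistics invisible to every `Ψ_f` (e.g. how holes of ONE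
pinched loop differ from holes of two touching loops is seen only through the non-linearity
`2cos(θ₁+θ₂+π/3) ≠ ∏ 2cos(θᵢ+π/3)`); the expansion needs the second-order structure of the (unknown) CLE₆
domain transform. -/
theorem stub_kernelUniqueness : DomainTransfer → KernelTransfer := by
  sorry

/-- STUB 5 (L) — `CascadeReconstruction`: merged first-generation kernels along every convergent loop
family ⇒ merged closed-b.c. domain laws in every ball (`KernelTransfer → DomainLawTransfer`; the ball is
`holeOf` of the round circle, a two-sided loop, constant family).  Mechanism: the exact lattice
MARKOV DECOMPOSITION on both lattices (multi-loop form of STUBS 1–2: given the first generation `(ℓᵢ)`, the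
configurations in the holes are independent percolations with the loop's own edges/sites pinned; inside a
type-1 loop the ensemble is the TYPE-SWAP of a closed-b.c. ensemble — exact colour symmetry of
`triSitePercolation half`, planar self-duality of bond-`ℤ²` at `1/2` with the half-mesh shift `δ(1+i)/2`,
absorbed by the families `u_δ − δc → u`; the hole of a medial loop `γ`, read on faces, is exactly
`meshVertices (holeOf γ − δc) δ`, vertex-induced); iterate to finite depth (the number of generations carrying a
loop of diameter `≥ η` inside `B(0,R)` is tight, BKKKW/RSW); couple generation by generation with
`cnLawEDist_triangle`: ℤ² in its hole `H^{ℤ²}` vs 𝕋 in the SAME hole (hypothesis, upgraded from continuous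
convergence to uniformity over the precompact family of hole loops — AB regularity; limits of lattice
holes are two-sided a.s.: no retraced arcs, a 6-arm/AB estimate) vs 𝕋 in its own
`ε`-close hole `H^{𝕋}` (continuity in law on the 𝕋 side: Camia–Newman convergence in converging Jordan
domains, CMP 268 Thm 5 / PTRF 139, + Radó continuity of CLE₆ + its Markov property).  Why it might fail /
the work: holes of bond-`ℤ²` medial loops are PINCHED (self-touching at bridges) — components are Jordan,
ensembles in different components independent; microscopic first-generation loops must be matched too
(`d_CN` has no lower cut-off: finite-energy density of isolated sites along the closed boundary cluster);
the 𝕋-side uniformity over converging domains must be vendored (Camia–Newman's Theorem for `(D_δ,·) → (D,·)`);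
and, below every scale, the soup bookkeeping that `d_CN` demands (every micro-loop of either ball ensemble
inside the window — isolated vertices/sites, faces, boundary-attached micro-loops — is `ε`-shadowed by a
same-type loop of the other w.h.p.; finite energy, union bound over `(R/ε)²` boxes). -/
theorem stub_cascadeReconstruction : KernelTransfer → DomainLawTransfer := by
  sorry

-- stub_windowLocality: LANDED (imported; see module docstring)

/-! ### Consistency: each named statement IS its registered stub (definitionally) -/

theorem oneGenerationZ2_holds : OneGenerationZ2 := oneGenerationZ2_of_stub
theorem oneGenerationT_holds : OneGenerationT := oneGenerationT_of_stub
theorem deAveraging_holds : DeAveraging := stub_deAveraging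
theorem kernelUniqueness_holds : KernelUniqueness := stub_kernelUniqueness
theorem cascadeReconstruction_holds : CascadeReconstruction := stub_cascadeReconstruction
theorem windowLocality_holds : WindowLocality := stub_windowLocality

/-! ### The composition: the crux BY NAME from the registered stubs -/

/-- **The crux BY NAME** (lead reshape r1, seat -1): `X = windowLocality (cascadeReconstruction
(kernelUniqueness (deAveraging OGF_ℤ² OGF_𝕋 MFZ2 MFT)))`.  STUBS 1, 2, 6 are the LANDED theorems
(`oneGenerationZ2_of_stub`, `oneGenerationT_of_stub`, `stub_windowLocality`, imported); the only
`sorry`s in the cone of this theorem are the three open registered stubs `stub_deAveraging`,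
`stub_kernelUniqueness`, `stub_cascadeReconstruction` declared above.  When they close, this theorem
closes `Summit.CriticalPhenomena.CardyFormulaZ2.Theses.CardyMagicRigidity.NestingRigidity`. -/
theorem NestingRigidity_of :
    Summit.CriticalPhenomena.CardyFormulaZ2.Theses.CardyMagicRigidity.NestingRigidity := by
  intro hZ2 hT
  exact stub_windowLocality (stub_cascadeReconstruction (stub_kernelUniqueness
    (stub_deAveraging oneGenerationZ2_of_stub oneGenerationT_of_stub hZ2 hT)))

/-! ### Name-keyed aliases of the three OPEN statements (hypothesis form of the composition) -/
namespace Registered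

/-- Alias of `DeAveraging` keyed by the registered stub name. -/
abbrev stub_deAveraging : Prop := DeAveraging
/-- Alias of `KernelUniqueness` keyed by the registered stub name. -/
abbrev stub_kernelUniqueness : Prop := KernelUniqueness
/-- Alias of `CascadeReconstruction` keyed by the registered stub name. -/
abbrev stub_cascadeReconstruction : Prop := CascadeReconstruction

end Registered

/-- Hypothesis form over the three OPEN stubs only (the landed ones are used as theorems): the glue
`nestingRigidity_of_statements` of the Defs module fed with the landed STUBS 1, 2, 6. -/
theorem nestingRigidity_of_open_stubs (h3 : Registered.stub_deAveraging)
    (h4 : Registered.stub_kernelUniqueness) (h5 : Registered.stub_cascadeReconstruction) :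
    Summit.CriticalPhenomena.CardyFormulaZ2.Theses.CardyMagicRigidity.NestingRigidity :=
  nestingRigidity_of_statements oneGenerationZ2_of_stub oneGenerationT_of_stub h3 h4 h5
    stub_windowLocality

/-- Barrier import check (Disproof used): the landed negative content for this crux is the barrier
`NestingTransformBlindness`, proved in the tree; no stub above is an instance of its refuted principles
(transform data alone ⇒ `d_CN`-identification). -/
example : Literature.Barriers.CriticalPhenomena.NestingTransformBlindness :=
  Literature.Barriers.CriticalPhenomena.nestingTransformBlindness_holds

end Summit.CriticalPhenomena.CardyFormulaZ2.Cruxes.NestingRigidity.MarkovCascadeOneGeneration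

end
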